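import Literature.NumberTheory.Automorphic.ArchRankOneJumpZero     -- ★ (K0±) LH10-p02 (g3): the one-sided values `g(0±)` and `hasOneSidedJump_two_sin_mul_integral_chart`
import HarnessLib

/-!
# The SPLIT side of the central wall of `U(1,1)`: the normalised hyperbolic orbital integral, in the RULED chart, is continuous through
# `x = 0` with value the full nilpotent-cone integral — the jump `g(0+) − g(0−)` of the elliptic side
# ((A0)-U11, chart level; Varadarajan 1989 §6.4 Lemma 21 / Thm 23, Harish-Chandra «`F_f^A(1)` = Rao's cone integral»; Shelstad 1979 Lemma 4.3)

Topic `NumberTheory/Automorphic`; namespace `Literature.NumberTheory.Automorphic`.  THEOREMS ONLY (no `def`, no instance, no notation, no axiom,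
no named fact, no `sorry`).  Cell `pub/hodgecm-mathlib`, line LH3 (closer stub `stub_N9`, crux H413 = `stmt-HodgeConjecture-24833`), DIRECT ROAD brick
**(A0)-U11, chart half** (LH3-plan (g2) 2026-09-02T06:39:35Z board; pen LH3-p01 (g3)): the split-side companion of ★ FILE M `ArchRankOneLimitFormula` /
★ (K0±) `ArchRankOneJumpZero`, which say «NOT HERE: the SPLIT-side value (A0) `|eˣ − e⁻ˣ|·Φ^A → c · cone integral`».

THE MATHEMATICS (`G₂ = U(1,1)`, form `J = diag(1,−1)`; `|z| = 1`).  The SPLIT Cartan `A` of `G₂` consists of the boosts with eigenvalues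
`a = z(s+σ)`, `b = z(s−σ)` (`s = cosh x = √(1+σ²)`, `σ = sinh x`) on the two NULL eigenlines; its conjugacy class is `{b·1 + (a−b)·Q}` with
`Q` running over the rank-one idempotents with `J Qᴴ J = 1 − Q` («null type»), a ONE-sheeted hyperboloid.  We use its RULED chart
`Q(t,θ) = (½+it, −(½+it)e^{−iθ}; −(½−it)e^{iθ}, ½−it)`, `(t,θ) ∈ ℝ × (0,2π]` (`tr Q = 1`, `det Q = 0`; for fixed `θ` the ruling `t ↦ Q(t,θ)` is a
straight line; `dt dθ` is the invariant measure, a `t`-dependent shear of the hat-box chart).  THE POINT: after the linear substitution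
`t = τ∕(2σ)` the chart point is AFFINE in `(τ, σ)` —
  `b·1 + (a−b)·Q(τ∕(2σ), θ) = zs·1 + τ·V + τ·W θ + σ·X θ`,  `V = diag(zi, −zi)`, `W θ = (0, −zi e^{−iθ}; zi e^{iθ}, 0)`, `X θ = (0, −z e^{−iθ}; −z e^{iθ}, 0)`
(§1; `V`, `W` are VERBATIM the data of ★ FILE K / (K0±)).  Hence the Weyl-normalised chart integral
`|a − b| · ∫_{ℝ×(0,2π]} f(b·1 + (a−b)·Q(t,θ)) dt dθ = ∫_{ℝ×(0,2π]} f(zs·1 + τ(V + Wθ) + σ Xθ) dτ dθ` (§2–§3, `σ ≠ 0`) is CONTINUOUS in `σ` through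
`σ = 0` (§4: dominated convergence, the `τ`-support being uniformly bounded through the functional `ℓ y = Re(conj(zi)·y₀₀)`, `ℓ V = 1`,
`ℓ W = ℓ X = 0`, `ℓ(zs·1) = 0`), with value at `σ = 0` the integral of `f` over the FULL LINE CONE
`∫_{τ∈ℝ, θ} f(z·1 + τ·N(θ))`, `N(θ) = V + W θ` nilpotent — which splits (§5, `τ ↦ −τ` on the lower half) as
`∫_{τ>0,θ} f(z·1 + τ·diag(zi,−zi) + τ·Wθ) + ∫_{τ>0,θ} f(z·1 + τ·diag(−zi,zi) + τ·(0, zi e^{−iθ}; −zi e^{iθ}, 0))` = VERBATIM the jump value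
`g(0+) − g(0−)` of ★ `hasOneSidedJump_two_sin_mul_integral_chart` (the second integrand of (K0±) on the nose, no `θ`-shift).  HEAD (§6):
`|a σ − b σ| · ∫ f(b σ·1 + (a σ − b σ)·Q) dt dθ → [that jump value]` as `σ → 0`, `σ ≠ 0` — Harish-Chandra's «`F_f^A` extends continuously to `1`
with value Rao's cone integral = the jump of `F_f^B`» for `U(1,1)`, at chart level.
NOT HERE: the GROUP-level orbit-chart identity for the split Cartan («HAT-BOX-hyp»: `∫_{U(1,1)⧸A} f(h·boost·h⁻¹) d(μ∕da) = C₂ · ∫_{ℝ×(0,2π]} f(b·1+(a−b)·Q) dt dθ`,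
the twin of ★ (HB) `ArchRankOneOrbitChart`), the transport to the `hypBlockGL` chart of `U(Φ₂)_w` (antidiagonal frame, ★ Cayley frame), and the product-quotient
step (PROD-QUOT-H) of (J-H).  HONEST LABEL: HC_CM is proved only modulo the 7 printed citations (2 remaining: hLiu418 = stmt-HodgeConjecture-24832, h413 =
stmt-HodgeConjecture-24833) until rung 0 closes; real analysis over Mathlib + ★ (K0±), count-neutral, pays nothing by itself.

WHAT IS PROVED (`f : Matrix (Fin 2) (Fin 2) ℂ → E` continuous with compact support for §4–§6; §2, §4 generic over a normed space `M`).
* §1 `smul_one_add_smul_nullChart_eq` (the affine chart identity), `det_nullChart`, `trace_nullChart`.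
* §2 (private) `abs_smul_setIntegral_univ_prod_eq_comp_div` (`(2|σ|)·∫_{ℝ×(0,2π]} G = ∫_{ℝ×(0,2π]} G(τ∕(2σ), θ)`, `σ ≠ 0`, no integrability hypothesis).
* §3 `abs_sub_smul_integral_nullChart_eq_integral_lineKernel`.
* §4 `tendsto_integral_lineKernel` (generic: `A` continuous, `W`, `X` continuous with `ℓ W = ℓ X = 0`, `ℓ V = 1`; two-sided `𝓝 0`).
* §5 (private) `setIntegral_univ_prod_eq_add_comp_neg` (the split `∫_{ℝ×S} F = ∫_{τ>0} F(τ,·) + ∫_{τ>0} F(−τ,·)`), `integral_lineCone_eq_add`.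
* §6 HEAD `tendsto_abs_sub_smul_integral_nullChart`.

## References
* [Varadarajan1989] V. S. Varadarajan, *An Introduction to Harmonic Analysis on Semisimple Lie Groups* (1989), §6.4 Lemma 21, Thm 23 (`F_f^A`, `F_f^B` at `1`; the jump).
* [Rogawski1990] J. D. Rogawski, *Automorphic Representations of Unitary Groups in Three Variables* (1990), §8.2 p. 119; §3.6 p. 31 (the split torus of `U(1,1)`).
* [Shelstad1979] D. Shelstad, *Characters and inner forms of a quasi-split group over ℝ*, Compositio Math. 39 (1979), Lemma 4.3 p. 25.
-/

set_option autoImplicit false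

noncomputable section

namespace Literature.NumberTheory.Automorphic

open _root_.MeasureTheory Set Filter _root_.Topology _root_.Complex
open scoped Real Matrix.Norms.Operator

variable {M E : Type*} [NormedAddCommGroup M] [NormedSpace ℝ M] [NormedAddCommGroup E] [NormedSpace ℝ E]

/-! ## §1 The ruled chart of the hyperbolic class and the affine chart identity -/

/-- **THE AFFINE CHART IDENTITY (hyperbolic class, ruled chart).**  For `a − b = 2σz` with `σ ≠ 0` and any `s` with `a + b = 2sz`... stated with
`a = z(s+σ)`, `b = z(s−σ)`: after `t = τ∕(2σ)` the chart point `b·1 + (a−b)·Q(t,θ)`, `Q(t,θ) = (½+it, −(½+it)e^{−iθ}; −(½−it)e^{iθ}, ½−it)`, equals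
`zs·1 + τ·diag(zi,−zi) + τ·(0, −zi e^{−iθ}; zi e^{iθ}, 0) + σ·(0, −z e^{−iθ}; −z e^{iθ}, 0)` — AFFINE in `(τ, σ)`.
[cite: Varadarajan1989, §6.4 Lemma 21] [cite: Rogawski1990, §3.6 p. 31] -/
theorem smul_one_add_smul_nullChart_eq (z s : ℂ) {σ : ℝ} (hσ : σ ≠ 0) (τ θ : ℝ) :
    (z * (s - σ)) • (1 : Matrix (Fin 2) (Fin 2) ℂ) +
      (z * (s + σ) - z * (s - σ)) •
        !![1 / 2 + ((τ / (2 * σ) : ℝ) : ℂ) * I, -(1 / 2 + ((τ / (2 * σ) : ℝ) : ℂ) * I) * cexp (-((θ : ℂ) * I));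
           -(1 / 2 - ((τ / (2 * σ) : ℝ) : ℂ) * I) * cexp ((θ : ℂ) * I), 1 / 2 - ((τ / (2 * σ) : ℝ) : ℂ) * I] =
      (z * s) • (1 : Matrix (Fin 2) (Fin 2) ℂ) + τ • Matrix.diagonal ![z * I, -(z * I)] +
        τ • !![(0 : ℂ), -(z * I) * cexp (-((θ : ℂ) * I)); (z * I) * cexp ((θ : ℂ) * I), 0] +
        σ • !![(0 : ℂ), -z * cexp (-((θ : ℂ) * I)); -z * cexp ((θ : ℂ) * I), 0] := by
  have hσ' : (σ : ℂ) ≠ 0 := by exact_mod_cast hσ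
  ext i j
  fin_cases i <;> fin_cases j <;>
    (simp [Matrix.smul_apply, Complex.real_smul]; field_simp; ring)

/-- The ruled chart consists of rank-one idempotents: `det Q(t,θ) = 0`. [cite: Varadarajan1989, §6.4] -/
theorem det_nullChart (t θ : ℝ) :
    Matrix.det !![1 / 2 + (t : ℂ) * I, -(1 / 2 + (t : ℂ) * I) * cexp (-((θ : ℂ) * I));
        -(1 / 2 - (t : ℂ) * I) * cexp ((θ : ℂ) * I), 1 / 2 - (t : ℂ) * I] = 0 := by
  rw [Matrix.det_fin_two_of]
  have h : cexp (-((θ : ℂ) * I)) * cexp ((θ : ℂ) * I) = 1 := by rw [← Complex.exp_add]; simp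
  linear_combination (-(1 / 2 + (t : ℂ) * I) * (1 / 2 - (t : ℂ) * I)) * h

/-- … and `tr Q(t,θ) = 1`. [cite: Varadarajan1989, §6.4] -/
theorem trace_nullChart (t θ : ℝ) :
    Matrix.trace !![1 / 2 + (t : ℂ) * I, -(1 / 2 + (t : ℂ) * I) * cexp (-((θ : ℂ) * I));
        -(1 / 2 - (t : ℂ) * I) * cexp ((θ : ℂ) * I), 1 / 2 - (t : ℂ) * I] = 1 := by
  rw [Matrix.trace_fin_two_of]; ring

/-! ## §2 The linear substitution `t = τ∕(2σ)` on the strip `ℝ × (0,2π]` -/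

/-- Change of variables `(τ, θ) ↦ (τ∕(2σ), θ)` of the strip `univ ×ˢ Ioc 0 (2π)` onto itself (Jacobian `(2|σ|)⁻¹`, `σ ≠ 0`):
`(2|σ|) · ∫_{ℝ×(0,2π]} G(t,θ) = ∫_{ℝ×(0,2π]} G(τ∕(2σ), θ)` (no integrability hypothesis). [folklore] -/
private theorem abs_smul_setIntegral_univ_prod_eq_comp_div (σ : ℝ) (hσ : σ ≠ 0) (G : ℝ × ℝ → E) :
    (2 * |σ|) • ∫ p in (univ : Set ℝ) ×ˢ Ioc (0 : ℝ) (2 * π), G p =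
      ∫ p in (univ : Set ℝ) ×ˢ Ioc (0 : ℝ) (2 * π), G (p.1 / (2 * σ), p.2) := by
  -- adapted from ★ FILE M `ArchRankOneLimitFormula` (private `smul_setIntegral_Ioi_one_eq`)
  have h2σ : 2 * σ ≠ 0 := mul_ne_zero two_ne_zero hσ
  have h2a : 0 < 2 * |σ| := by positivity
  set e : ℝ × ℝ →L[ℝ] ℝ × ℝ :=
    ((2 * σ)⁻¹ • ContinuousLinearMap.id ℝ ℝ).prodMap (ContinuousLinearMap.id ℝ ℝ) with he
  set φ : ℝ × ℝ → ℝ × ℝ := fun p => (p.1 / (2 * σ), p.2) with hφ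
  have hφe : φ = fun p => e p :=
    funext fun p => Prod.ext (by simp [φ, e, div_eq_inv_mul]) (by simp [φ, e])
  have hS : MeasurableSet ((univ : Set ℝ) ×ˢ Ioc (0 : ℝ) (2 * π)) := MeasurableSet.univ.prod measurableSet_Ioc
  have hderiv : ∀ p ∈ (univ : Set ℝ) ×ˢ Ioc (0 : ℝ) (2 * π),
      HasFDerivWithinAt φ e ((univ : Set ℝ) ×ˢ Ioc (0 : ℝ) (2 * π)) p := by
    intro p _; rw [hφe]; exact e.hasFDerivAt.hasFDerivWithinAt
  have hinj : InjOn φ ((univ : Set ℝ) ×ˢ Ioc (0 : ℝ) (2 * π)) := by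
    intro p _ q _ hpq
    simp only [φ, Prod.mk.injEq] at hpq
    exact Prod.ext (by simpa [div_left_inj' h2σ] using hpq.1) hpq.2
  have himage : φ '' ((univ : Set ℝ) ×ˢ Ioc (0 : ℝ) (2 * π)) = (univ : Set ℝ) ×ˢ Ioc (0 : ℝ) (2 * π) := by
    have : φ = Prod.map (fun τ : ℝ => τ / (2 * σ)) id := by funext p; rfl
    rw [this, Set.prodMap_image_prod, Set.image_id]
    congr 1
    refine Set.eq_univ_of_forall fun s => ⟨2 * σ * s, Set.mem_univ _, by field_simp⟩
  have hdet : e.det = (2 * σ)⁻¹ := by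
    simp only [e, ContinuousLinearMap.det, ContinuousLinearMap.coe_prodMap, LinearMap.det_prodMap,
      ContinuousLinearMap.toLinearMap_smul, ContinuousLinearMap.coe_id, LinearMap.det_smul,
      LinearMap.det_id, Module.finrank_self, pow_one, mul_one]
  have key := integral_image_eq_integral_abs_det_fderiv_smul (μ := volume) hS hderiv hinj G
  rw [himage] at key
  rw [key, hdet, abs_inv, abs_mul, abs_of_pos (zero_lt_two' ℝ), integral_smul, smul_smul, mul_inv_cancel₀ h2a.ne', one_smul]

/-! ## §3 The normalised chart integral is the LINE-kernel integral -/

/-- `|a − b| = 2|σ|` for `a = z(s+σ)`, `b = z(s−σ)`, `|z| = 1`. [folklore] -/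
private theorem norm_mul_add_sub_mul_sub (z s : ℂ) (hz : ‖z‖ = 1) (σ : ℝ) : ‖z * (s + σ) - z * (s - σ)‖ = 2 * |σ| := by
  have : z * (s + σ) - z * (s - σ) = z * (2 * σ) := by ring
  rw [this, norm_mul, hz, one_mul, norm_mul, Complex.norm_two, Complex.norm_real, Real.norm_eq_abs]

/-- **The normalised hyperbolic chart integral is the line-kernel integral** (`σ ≠ 0`, `|z| = 1`):
`|a − b| · ∫_{ℝ×(0,2π]} f(b·1 + (a−b)·Q(t,θ)) dt dθ = ∫_{ℝ×(0,2π]} f(zs·1 + τ·V + τ·Wθ + σ·Xθ) dτ dθ`. [cite: Varadarajan1989, §6.4 Lemma 21] -/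
theorem abs_sub_smul_integral_nullChart_eq_integral_lineKernel (f : Matrix (Fin 2) (Fin 2) ℂ → E) (z s : ℂ) (hz : ‖z‖ = 1)
    {σ : ℝ} (hσ : σ ≠ 0) :
    ‖z * (s + σ) - z * (s - σ)‖ • ∫ p in (univ : Set ℝ) ×ˢ Ioc (0 : ℝ) (2 * π),
        f ((z * (s - σ)) • (1 : Matrix (Fin 2) (Fin 2) ℂ) +
          (z * (s + σ) - z * (s - σ)) •
            !![1 / 2 + ((p.1 : ℝ) : ℂ) * I, -(1 / 2 + ((p.1 : ℝ) : ℂ) * I) * cexp (-((p.2 : ℂ) * I));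
               -(1 / 2 - ((p.1 : ℝ) : ℂ) * I) * cexp ((p.2 : ℂ) * I), 1 / 2 - ((p.1 : ℝ) : ℂ) * I]) =
      ∫ p in (univ : Set ℝ) ×ˢ Ioc (0 : ℝ) (2 * π),
        f ((z * s) • (1 : Matrix (Fin 2) (Fin 2) ℂ) + p.1 • Matrix.diagonal ![z * I, -(z * I)] +
          p.1 • !![(0 : ℂ), -(z * I) * cexp (-((p.2 : ℂ) * I)); (z * I) * cexp ((p.2 : ℂ) * I), 0] +
          σ • !![(0 : ℂ), -z * cexp (-((p.2 : ℂ) * I)); -z * cexp ((p.2 : ℂ) * I), 0]) := by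
  rw [norm_mul_add_sub_mul_sub z s hz σ, abs_smul_setIntegral_univ_prod_eq_comp_div σ hσ]
  refine setIntegral_congr_fun (MeasurableSet.univ.prod measurableSet_Ioc) fun p _ => ?_
  dsimp only
  rw [smul_one_add_smul_nullChart_eq z s hσ p.1 p.2]

/-! ## §4 The line-kernel integral is continuous at `σ = 0` (generic data) -/

omit [NormedSpace ℝ E] in
/-- A compactly supported map vanishes wherever a continuous linear functional is large. [folklore] -/
private theorem exists_forall_eq_zero_of_lt_abs' {f : M → E} (hfc : HasCompactSupport f) (ℓ : M →L[ℝ] ℝ) :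
    ∃ R : ℝ, ∀ x, R < |ℓ x| → f x = 0 := by
  -- adapted from ★ FILE K `ArchRankOneLimitKernel` (private `exists_forall_eq_zero_of_lt_abs`)
  obtain ⟨R, hR⟩ := hfc.isCompact.exists_bound_of_continuousOn (f := fun x => ℓ x) ℓ.continuous.continuousOn
  refine ⟨R, fun x hx => image_eq_zero_of_notMem_tsupport fun h => ?_⟩
  have h1 := hR x h
  simp only [Real.norm_eq_abs] at h1
  linarith

omit [NormedSpace ℝ E] in
/-- Uniform vanishing radius in `τ` for the line kernel: for `|σ| ≤ 1` and `R ≤ |τ|` the integrand vanishes at `A σ + τ·V + τ·W θ + σ·X θ`.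
[folklore] -/
private theorem exists_radius_line {f : M → E} (hfc : HasCompactSupport f) {A : ℝ → M} (hA : Continuous A) (V : M)
    (W X : ℝ → M) (ℓ : M →L[ℝ] ℝ) (hℓV : ℓ V = 1) (hℓW : ∀ θ, ℓ (W θ) = 0) (hℓX : ∀ θ, ℓ (X θ) = 0) :
    ∃ R : ℝ, 0 < R ∧ ∀ σ τ θ : ℝ, |σ| ≤ 1 → R ≤ |τ| → f (A σ + τ • V + τ • W θ + σ • X θ) = 0 := by
  obtain ⟨Rf, hRf⟩ := exists_forall_eq_zero_of_lt_abs' hfc ℓ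
  obtain ⟨CA, hCA⟩ := (isCompact_Icc (a := (-1 : ℝ)) (b := 1)).exists_bound_of_continuousOn
    (f := fun σ => ℓ (A σ)) (ℓ.continuous.comp hA).continuousOn
  refine ⟨|Rf| + |CA| + 1, by positivity, fun σ τ θ hσ hτ => hRf _ ?_⟩
  have h1 : |ℓ (A σ)| ≤ |CA| := (hCA σ (abs_le.1 hσ)).trans (by simpa [Real.norm_eq_abs] using le_abs_self CA)
  have hval : ℓ (A σ + τ • V + τ • W θ + σ • X θ) = ℓ (A σ) + τ := by
    simp [map_add, map_smul, hℓV, hℓW, hℓX]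
  rw [hval]
  have h2 : |τ| - |ℓ (A σ)| ≤ |ℓ (A σ) + τ| := by
    have := abs_sub_abs_le_abs_sub τ (-ℓ (A σ))
    rw [abs_neg, sub_neg_eq_add, add_comm] at this
    exact this
  calc Rf ≤ |Rf| := le_abs_self _
    _ < |τ| - |ℓ (A σ)| := by linarith
    _ ≤ |ℓ (A σ) + τ| := h2

/-- The constant `C` on `{|τ| ≤ R}` is integrable on the strip `ℝ × (0,2π]`. [folklore] -/
private theorem integrable_indicator_strip (C R : ℝ) :
    Integrable (indicator (Icc (-R) R ×ˢ (univ : Set ℝ)) fun _ : ℝ × ℝ => C)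
      (volume.restrict ((univ : Set ℝ) ×ˢ Ioc (0 : ℝ) (2 * π))) := by
  refine (integrable_indicator_iff (measurableSet_Icc.prod MeasurableSet.univ)).2 ?_
  rw [IntegrableOn, Measure.restrict_restrict (measurableSet_Icc.prod MeasurableSet.univ)]
  refine integrableOn_const ?_
  refine ne_of_lt (lt_of_le_of_lt (measure_mono ?_ : _ ≤ volume (Icc (-R) R ×ˢ Ioc (0 : ℝ) (2 * π))) ?_)
  · rintro ⟨a, b⟩ ⟨⟨ha, -⟩, ⟨-, hb⟩⟩
    exact ⟨ha, hb⟩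
  · rw [Measure.volume_eq_prod, Measure.prod_prod, Real.volume_Icc, Real.volume_Ioc]
    exact ENNReal.mul_lt_top ENNReal.ofReal_lt_top ENNReal.ofReal_lt_top

omit [NormedSpace ℝ E] in
/-- The bound `indicator {|τ| ≤ R} C` dominates a function vanishing for `R ≤ |τ|` and bounded by `C`. [folklore] -/
private theorem norm_le_indicator_strip {g : ℝ × ℝ → E} {C R : ℝ} {p : ℝ × ℝ} (hC : ‖g p‖ ≤ C) (hR : R ≤ |p.1| → g p = 0) :
    ‖g p‖ ≤ indicator (Icc (-R) R ×ˢ (univ : Set ℝ)) (fun _ : ℝ × ℝ => |C|) p := by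
  by_cases h : R ≤ |p.1|
  · rw [hR h, norm_zero]
    exact indicator_nonneg (fun _ _ => abs_nonneg C) _
  · have h' : p.1 ∈ Icc (-R) R := abs_le.1 (le_of_lt (not_le.1 h))
    rw [indicator_of_mem (show p ∈ Icc (-R) R ×ˢ (univ : Set ℝ) from ⟨h', trivial⟩)]
    exact hC.trans (le_abs_self C)

/-- **The line-kernel integral is continuous at `σ = 0`** (generic data; only continuity of `f` is used): for `A` continuous, `W`, `X` continuous
families killed by a functional `ℓ` with `ℓ V = 1`, and `f` continuous with compact support,
`σ ↦ ∫_{ℝ×(0,2π]} f(A σ + τ·V + τ·W θ + σ·X θ) dτ dθ → ∫_{ℝ×(0,2π]} f(A 0 + τ·V + τ·W θ) dτ dθ` as `σ → 0`.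
[cite: Varadarajan1989, §6.4 Lemma 21, Thm 23] -/
theorem tendsto_integral_lineKernel (f : M → E) (hf : Continuous f) (hfc : HasCompactSupport f)
    (A : ℝ → M) (hA : Continuous A) (V : M) (W X : ℝ → M) (hW : Continuous W) (hX : Continuous X) (ℓ : M →L[ℝ] ℝ)
    (hℓV : ℓ V = 1) (hℓW : ∀ θ, ℓ (W θ) = 0) (hℓX : ∀ θ, ℓ (X θ) = 0) :
    Tendsto (fun σ => ∫ p in (univ : Set ℝ) ×ˢ Ioc (0 : ℝ) (2 * π),
        f (A σ + p.1 • V + p.1 • W p.2 + σ • X p.2)) (𝓝 0)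
      (𝓝 (∫ p in (univ : Set ℝ) ×ˢ Ioc (0 : ℝ) (2 * π), f (A 0 + p.1 • V + p.1 • W p.2))) := by
  have hSm : MeasurableSet ((univ : Set ℝ) ×ˢ Ioc (0 : ℝ) (2 * π)) := MeasurableSet.univ.prod measurableSet_Ioc
  obtain ⟨R, -, hR⟩ := exists_radius_line hfc hA V W X ℓ hℓV hℓW hℓX
  obtain ⟨Cf0, hCf0⟩ := hfc.exists_bound_of_continuous hf
  have h0 : (∫ p in (univ : Set ℝ) ×ˢ Ioc (0 : ℝ) (2 * π), f (A 0 + p.1 • V + p.1 • W p.2 + (0 : ℝ) • X p.2)) =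
      ∫ p in (univ : Set ℝ) ×ˢ Ioc (0 : ℝ) (2 * π), f (A 0 + p.1 • V + p.1 • W p.2) := by
    refine setIntegral_congr_fun hSm fun p _ => ?_
    rw [zero_smul, add_zero]
  rw [← h0]
  have hev : ∀ᶠ σ in 𝓝 (0 : ℝ), |σ| ≤ 1 := by
    filter_upwards [Icc_mem_nhds (show (-1 : ℝ) < 0 by norm_num) (show (0 : ℝ) < 1 by norm_num)] with σ hσ
    exact abs_le.2 ⟨hσ.1, hσ.2⟩
  have hchart : ∀ σ : ℝ, Continuous fun p : ℝ × ℝ => A σ + p.1 • V + p.1 • W p.2 + σ • X p.2 := fun σ =>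
    ((continuous_const.add (continuous_fst.smul continuous_const)).add
      (continuous_fst.smul (hW.comp continuous_snd))).add (continuous_const.smul (hX.comp continuous_snd))
  refine (continuousAt_of_dominated (μ := volume.restrict ((univ : Set ℝ) ×ˢ Ioc (0 : ℝ) (2 * π)))
    (bound := indicator (Icc (-R) R ×ˢ (univ : Set ℝ)) fun _ : ℝ × ℝ => |Cf0|) ?_ ?_
    (integrable_indicator_strip _ R) ?_).tendsto
  · exact Eventually.of_forall fun σ => (hf.comp (hchart σ)).aestronglyMeasurable
  · filter_upwards [hev] with σ hσ
    exact Eventually.of_forall fun p =>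
      norm_le_indicator_strip (g := fun p : ℝ × ℝ => f (A σ + p.1 • V + p.1 • W p.2 + σ • X p.2)) (p := p) (hCf0 _)
        fun hRp => hR σ p.1 p.2 hσ hRp
  · exact Eventually.of_forall fun p =>
      (hf.comp ((((hA.add continuous_const).add continuous_const)).add
        (continuous_id.smul continuous_const))).continuousAt

/-- The support-control functional `ℓ(y) = Re(c̄ y₀₀)∕|c|²`: `ℓ(diag(c,−c)) = 1` and `ℓ y = 0` whenever `y₀₀ = 0`. [folklore] -/
private theorem exists_lineFunctional (c : ℂ) (hc : c ≠ 0) :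
    ∃ ℓ : Matrix (Fin 2) (Fin 2) ℂ →L[ℝ] ℝ,
      ℓ (Matrix.diagonal ![c, -c]) = 1 ∧ ∀ y : Matrix (Fin 2) (Fin 2) ℂ, y 0 0 = 0 → ℓ y = 0 := by
  -- adapted from ★ FILE M `ArchRankOneLimitFormula` (private `exists_functional`)
  refine ⟨LinearMap.toContinuousLinearMap
    { toFun := fun y => ((starRingEnd ℂ) c * y 0 0).re / Complex.normSq c
      map_add' := fun x y => by simp [mul_add, add_div]
      map_smul' := fun r x => by
        simp only [Matrix.smul_apply, Complex.real_smul, RingHom.id_apply, smul_eq_mul]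
        rw [mul_left_comm, Complex.re_ofReal_mul, mul_div_assoc] }, ?_, fun y hy => ?_⟩
  · simp only [LinearMap.coe_toContinuousLinearMap', LinearMap.coe_mk, AddHom.coe_mk,
      Matrix.diagonal_apply_eq, Matrix.cons_val_zero]
    rw [← Complex.normSq_eq_conj_mul_self, Complex.ofReal_re]
    exact div_self (Complex.normSq_pos.2 hc).ne'
  · simp only [LinearMap.coe_toContinuousLinearMap', LinearMap.coe_mk, AddHom.coe_mk, hy, mul_zero, Complex.zero_re, zero_div]

/-! ## §5 Splitting the line cone into the two half-cones -/

/-- **`∫_{ℝ×S} F = ∫_{(0,∞)×S} F(τ,θ) + ∫_{(0,∞)×S} F(−τ,θ)`** for `F` integrable on the strip (`ℝ = (0,∞) ∪ (−∞,0]`, and `τ ↦ −τ` maps `(0,∞)` onto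
`(−∞,0)`, which differs from `(−∞,0]` by a null line). [folklore] -/
private theorem setIntegral_univ_prod_eq_add_comp_neg {S : Set ℝ} (hS : MeasurableSet S) (F : ℝ × ℝ → E)
    (hF : IntegrableOn F ((univ : Set ℝ) ×ˢ S) volume) :
    ∫ p in (univ : Set ℝ) ×ˢ S, F p = (∫ p in Ioi (0 : ℝ) ×ˢ S, F p) + ∫ p in Ioi (0 : ℝ) ×ˢ S, F (-p.1, p.2) := by
  -- `univ ×ˢ S = (Ioi 0 ×ˢ S) ∪ (Iic 0 ×ˢ S)`, disjoint
  have hsplit : (univ : Set ℝ) ×ˢ S = (Ioi (0 : ℝ) ×ˢ S) ∪ (Iic (0 : ℝ) ×ˢ S) := by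
    rw [← Set.union_prod, Set.Ioi_union_Iic]
  have hdisj : Disjoint (Ioi (0 : ℝ) ×ˢ S) (Iic (0 : ℝ) ×ˢ S) :=
    Set.disjoint_prod.2 (Or.inl (Set.disjoint_left.2 fun x (hx : 0 < x) (hx' : x ≤ 0) => (not_le.2 hx) hx'))
  rw [hsplit, setIntegral_union hdisj (measurableSet_Iic.prod hS) (hF.mono_set (by rw [hsplit]; exact subset_union_left))
    (hF.mono_set (by rw [hsplit]; exact subset_union_right))]
  congr 1
  -- the reflection `τ ↦ −τ` carries `Ioi 0 ×ˢ S` onto `Iio 0 ×ˢ S`, a.e. equal to `Iic 0 ×ˢ S`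
  have hae : (Iic (0 : ℝ) ×ˢ S : Set (ℝ × ℝ)) =ᵐ[volume] (Iio (0 : ℝ) ×ˢ S : Set (ℝ × ℝ)) := by
    rw [Measure.volume_eq_prod]
    exact Measure.set_prod_ae_eq Iio_ae_eq_Iic.symm (ae_eq_refl S)
  rw [setIntegral_congr_set hae]
  set e : ℝ × ℝ →L[ℝ] ℝ × ℝ := ((-1 : ℝ) • ContinuousLinearMap.id ℝ ℝ).prodMap (ContinuousLinearMap.id ℝ ℝ) with he
  have heq : (fun p : ℝ × ℝ => ((-p.1, p.2) : ℝ × ℝ)) = fun p => e p :=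
    funext fun p => Prod.ext (by simp [e]) (by simp [e])
  have hSm : MeasurableSet (Ioi (0 : ℝ) ×ˢ S) := measurableSet_Ioi.prod hS
  have hderiv : ∀ p ∈ Ioi (0 : ℝ) ×ˢ S, HasFDerivWithinAt (fun p : ℝ × ℝ => ((-p.1, p.2) : ℝ × ℝ)) e (Ioi (0 : ℝ) ×ˢ S) p := by
    intro p _; rw [heq]; exact e.hasFDerivAt.hasFDerivWithinAt
  have hinj : InjOn (fun p : ℝ × ℝ => ((-p.1, p.2) : ℝ × ℝ)) (Ioi (0 : ℝ) ×ˢ S) := by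
    intro p _ q _ hpq
    simp only [Prod.mk.injEq, neg_inj] at hpq
    exact Prod.ext hpq.1 hpq.2
  have himage : (fun p : ℝ × ℝ => ((-p.1, p.2) : ℝ × ℝ)) '' (Ioi (0 : ℝ) ×ˢ S) = Iio (0 : ℝ) ×ˢ S := by
    have : (fun p : ℝ × ℝ => ((-p.1, p.2) : ℝ × ℝ)) = Prod.map (fun τ : ℝ => -τ) id := by funext p; rfl
    rw [this, Set.prodMap_image_prod, Set.image_id, Set.image_neg_Ioi, neg_zero]
  have hdet : e.det = -1 := by
    simp only [e, ContinuousLinearMap.det, ContinuousLinearMap.coe_prodMap, LinearMap.det_prodMap,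
      ContinuousLinearMap.toLinearMap_smul, ContinuousLinearMap.coe_id, LinearMap.det_smul,
      LinearMap.det_id, Module.finrank_self, pow_one, mul_one]
  have key := integral_image_eq_integral_abs_det_fderiv_smul (μ := volume) hSm hderiv hinj F
  rw [himage] at key
  rw [key, hdet]
  simp

/-- **The line cone splits into the two half-cones of ★ (K0±)**: for `f` continuous with compact support,
`∫_{τ∈ℝ, θ∈(0,2π]} f(z·1 + τ·V + τ·Wθ) = ∫_{τ>0,θ} f(z·1 + τ·diag(zi,−zi) + τ·Wθ) + ∫_{τ>0,θ} f(z·1 + τ·diag(−zi,zi) + τ·(0, zi e^{−iθ}; −zi e^{iθ}, 0))`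
— VERBATIM the jump value of ★ `hasOneSidedJump_two_sin_mul_integral_chart`. [cite: Varadarajan1989, §6.4 Thm 23] [cite: Shelstad1979, Lemma 4.3 p. 25] -/
theorem integral_lineCone_eq_add (f : Matrix (Fin 2) (Fin 2) ℂ → E) (hf : Continuous f) (hfc : HasCompactSupport f) (z : ℂ) (hz : z ≠ 0) :
    (∫ p in (univ : Set ℝ) ×ˢ Ioc (0 : ℝ) (2 * π),
        f (z • (1 : Matrix (Fin 2) (Fin 2) ℂ) + p.1 • Matrix.diagonal ![z * I, -(z * I)] +
          p.1 • !![(0 : ℂ), -(z * I) * cexp (-((p.2 : ℂ) * I)); (z * I) * cexp ((p.2 : ℂ) * I), 0])) =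
      (∫ p in Ioi (0 : ℝ) ×ˢ Ioc (0 : ℝ) (2 * π),
        f (z • (1 : Matrix (Fin 2) (Fin 2) ℂ) + p.1 • Matrix.diagonal ![z * I, -(z * I)] +
          p.1 • !![(0 : ℂ), -(z * I) * cexp (-((p.2 : ℂ) * I)); (z * I) * cexp ((p.2 : ℂ) * I), 0])) +
       ∫ p in Ioi (0 : ℝ) ×ˢ Ioc (0 : ℝ) (2 * π),
        f (z • (1 : Matrix (Fin 2) (Fin 2) ℂ) + p.1 • Matrix.diagonal ![-(z * I), z * I] +
          p.1 • !![(0 : ℂ), (z * I) * cexp (-((p.2 : ℂ) * I)); -(z * I) * cexp ((p.2 : ℂ) * I), 0]) := by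
  -- integrability on the strip: continuous, bounded, vanishing for `|τ| ≥ R`
  have hzu : z * I ≠ 0 := mul_ne_zero hz Complex.I_ne_zero
  obtain ⟨ℓ, hℓV, hℓ00⟩ := exists_lineFunctional (z * I) hzu
  set W : ℝ → Matrix (Fin 2) (Fin 2) ℂ := fun θ => !![(0 : ℂ), -(z * I) * cexp (-((θ : ℂ) * I)); (z * I) * cexp ((θ : ℂ) * I), 0] with hW
  have hWc : Continuous W := by
    refine continuous_matrix fun i j => ?_
    fin_cases i <;> fin_cases j <;> simp [W] <;> fun_prop
  set F : ℝ × ℝ → E := fun p => f (z • (1 : Matrix (Fin 2) (Fin 2) ℂ) + p.1 • Matrix.diagonal ![z * I, -(z * I)] + p.1 • W p.2) with hF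
  have hFc : Continuous F := hf.comp ((continuous_const.add (continuous_fst.smul continuous_const)).add
    (continuous_fst.smul (hWc.comp continuous_snd)))
  obtain ⟨R, -, hR⟩ := exists_radius_line hfc (continuous_const : Continuous fun _ : ℝ => z • (1 : Matrix (Fin 2) (Fin 2) ℂ))
    (Matrix.diagonal ![z * I, -(z * I)]) W (fun _ => 0) ℓ hℓV (fun θ => hℓ00 _ (by simp [W])) (fun _ => hℓ00 _ rfl)
  obtain ⟨Cf0, hCf0⟩ := hfc.exists_bound_of_continuous hf
  have hFint : IntegrableOn F ((univ : Set ℝ) ×ˢ Ioc (0 : ℝ) (2 * π)) volume := by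
    refine (integrable_indicator_strip |Cf0| R).mono' hFc.aestronglyMeasurable (Eventually.of_forall fun p => ?_)
    refine norm_le_indicator_strip (g := F) (hCf0 _) fun hRp => ?_
    have h := hR 0 p.1 p.2 (by simp) hRp
    simpa [F, W] using h
  rw [setIntegral_univ_prod_eq_add_comp_neg measurableSet_Ioc F hFint]
  congr 1
  refine setIntegral_congr_fun (measurableSet_Ioi.prod measurableSet_Ioc) fun p _ => ?_
  simp only [F, W]
  congr 1
  ext i j
  fin_cases i <;> fin_cases j <;> simp [Matrix.smul_apply]

/-! ## §6 The head: the normalised hyperbolic chart integral tends to the jump value of the elliptic side -/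

/-- **(A0)-U11 AT CHART LEVEL — THE SPLIT SIDE IS CONTINUOUS THROUGH THE WALL WITH VALUE THE JUMP OF THE COMPACT SIDE.**  For `f` continuous with
compact support on `M₂(ℂ)`, `|z| = 1` and any continuous `s : ℝ → ℂ` with `s 0 = 1` (e.g. `s σ = √(1+σ²)`; boost eigenvalues `a = z(s σ + σ)`,
`b = z(s σ − σ)`), the Weyl-normalised integral of `f` over the ruled chart of the hyperbolic class,
`|a − b| · ∫_{ℝ×(0,2π]} f(b·1 + (a−b)·Q(t,θ)) dt dθ`, tends as `σ → 0`, `σ ≠ 0`, to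
`∫_{τ>0,θ} f(z·1 + τ·N θ) + ∫_{τ>0,θ} f(z·1 − τ·N θ)` — VERBATIM the jump `g(0+) − g(0−)` of ★ `hasOneSidedJump_two_sin_mul_integral_chart`
(Harish-Chandra: `F_f^A` is continuous at the wall and `F_f^A(z·1)` = Rao's cone integral = the jump of `F_f^B`).
[cite: Varadarajan1989, §6.4 Lemma 21, Thm 23] [cite: Shelstad1979, Lemma 4.3 p. 25] [cite: Rogawski1990, §8.2 p. 119] -/
theorem tendsto_abs_sub_smul_integral_nullChart (f : Matrix (Fin 2) (Fin 2) ℂ → E) (hf : Continuous f) (hfc : HasCompactSupport f)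
    (z : ℂ) (hz : ‖z‖ = 1) (s : ℝ → ℂ) (hs : Continuous s) (hs0 : s 0 = 1) :
    Tendsto (fun σ : ℝ => ‖z * (s σ + σ) - z * (s σ - σ)‖ • ∫ p in (univ : Set ℝ) ×ˢ Ioc (0 : ℝ) (2 * π),
        f ((z * (s σ - σ)) • (1 : Matrix (Fin 2) (Fin 2) ℂ) +
          (z * (s σ + σ) - z * (s σ - σ)) •
            !![1 / 2 + ((p.1 : ℝ) : ℂ) * I, -(1 / 2 + ((p.1 : ℝ) : ℂ) * I) * cexp (-((p.2 : ℂ) * I));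
               -(1 / 2 - ((p.1 : ℝ) : ℂ) * I) * cexp ((p.2 : ℂ) * I), 1 / 2 - ((p.1 : ℝ) : ℂ) * I]))
      (𝓝[≠] 0)
      (𝓝 ((∫ p in Ioi (0 : ℝ) ×ˢ Ioc (0 : ℝ) (2 * π),
        f (z • (1 : Matrix (Fin 2) (Fin 2) ℂ) + p.1 • Matrix.diagonal ![z * I, -(z * I)] +
          p.1 • !![(0 : ℂ), -(z * I) * cexp (-((p.2 : ℂ) * I)); (z * I) * cexp ((p.2 : ℂ) * I), 0])) +
       ∫ p in Ioi (0 : ℝ) ×ˢ Ioc (0 : ℝ) (2 * π),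
        f (z • (1 : Matrix (Fin 2) (Fin 2) ℂ) + p.1 • Matrix.diagonal ![-(z * I), z * I] +
          p.1 • !![(0 : ℂ), (z * I) * cexp (-((p.2 : ℂ) * I)); -(z * I) * cexp ((p.2 : ℂ) * I), 0]))) := by
  have hz0 : z ≠ 0 := by rintro rfl; simp at hz
  -- the model data
  obtain ⟨A, hA⟩ : ∃ A : ℝ → Matrix (Fin 2) (Fin 2) ℂ, A = fun σ => (z * s σ) • (1 : Matrix (Fin 2) (Fin 2) ℂ) := ⟨_, rfl⟩
  obtain ⟨V, hV⟩ : ∃ V : Matrix (Fin 2) (Fin 2) ℂ, V = Matrix.diagonal ![z * I, -(z * I)] := ⟨_, rfl⟩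
  obtain ⟨W, hW⟩ : ∃ W : ℝ → Matrix (Fin 2) (Fin 2) ℂ,
      W = fun θ : ℝ => !![(0 : ℂ), -(z * I) * cexp (-((θ : ℂ) * I)); (z * I) * cexp ((θ : ℂ) * I), 0] := ⟨_, rfl⟩
  obtain ⟨X, hX⟩ : ∃ X : ℝ → Matrix (Fin 2) (Fin 2) ℂ,
      X = fun θ : ℝ => !![(0 : ℂ), -z * cexp (-((θ : ℂ) * I)); -z * cexp ((θ : ℂ) * I), 0] := ⟨_, rfl⟩
  have hzu : z * I ≠ 0 := mul_ne_zero hz0 Complex.I_ne_zero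
  -- the support functional `ℓ y = Re(conj(zi) y₀₀) ∕ |zi|²`
  obtain ⟨ℓ, hℓV', hℓ00⟩ := exists_lineFunctional (z * I) hzu
  have hℓV : ℓ V = 1 := by rw [hV]; exact hℓV'
  have hℓW : ∀ θ, ℓ (W θ) = 0 := fun θ => hℓ00 _ (by rw [hW]; simp)
  have hℓX : ∀ θ, ℓ (X θ) = 0 := fun θ => hℓ00 _ (by rw [hX]; simp)
  have hAc : Continuous A := by rw [hA]; exact (continuous_const.mul hs).smul continuous_const
  have hWc : Continuous W := by
    rw [hW]; refine continuous_matrix fun i j => ?_; fin_cases i <;> fin_cases j <;> simp <;> fun_prop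
  have hXc : Continuous X := by
    rw [hX]; refine continuous_matrix fun i j => ?_; fin_cases i <;> fin_cases j <;> simp <;> fun_prop
  -- §4: the line-kernel integral is continuous at `σ = 0`
  have hK := tendsto_integral_lineKernel f hf hfc A hAc V W X hWc hXc ℓ hℓV hℓW hℓX
  have hA0 : A 0 = z • (1 : Matrix (Fin 2) (Fin 2) ℂ) := by simp only [hA, hs0, mul_one]
  rw [hA0] at hK
  -- §5: the value at `σ = 0` is the jump value
  have hsplit := integral_lineCone_eq_add f hf hfc z hz0
  rw [hV, hW] at hK
  rw [hsplit] at hK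
  -- §3: off `σ = 0` the normalised chart integral IS the line-kernel integral
  have hev : (fun σ : ℝ => ‖z * (s σ + σ) - z * (s σ - σ)‖ • ∫ p in (univ : Set ℝ) ×ˢ Ioc (0 : ℝ) (2 * π),
        f ((z * (s σ - σ)) • (1 : Matrix (Fin 2) (Fin 2) ℂ) +
          (z * (s σ + σ) - z * (s σ - σ)) •
            !![1 / 2 + ((p.1 : ℝ) : ℂ) * I, -(1 / 2 + ((p.1 : ℝ) : ℂ) * I) * cexp (-((p.2 : ℂ) * I));
               -(1 / 2 - ((p.1 : ℝ) : ℂ) * I) * cexp ((p.2 : ℂ) * I), 1 / 2 - ((p.1 : ℝ) : ℂ) * I])) =ᶠ[𝓝[≠] 0]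
      fun σ => ∫ p in (univ : Set ℝ) ×ˢ Ioc (0 : ℝ) (2 * π), f (A σ + p.1 • V + p.1 • W p.2 + σ • X p.2) := by
    filter_upwards [self_mem_nhdsWithin] with σ hσ
    rw [hA, hV, hW, hX]
    exact abs_sub_smul_integral_nullChart_eq_integral_lineKernel f z (s σ) hz hσ
  rw [hA, hV, hW, hX] at hev
  rw [hA, hX] at hK
  exact ((hK.mono_left nhdsWithin_le_nhds).congr' hev.symm)

end Literature.NumberTheory.Automorphic

end
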